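import Summits.Ventures.PercRepro.RankLevelSetLevelSevenRowSeventyOne
import Summits.Ventures.PercRepro.RankLevelSetCoreSevenOfFormGXT
import Summits.Ventures.PercRepro.RankLevelSetLevelSevenRowSeventyGXTForm
import Summits.Ventures.PercRepro.RankLevelSetLevelSevenRowSeventyLarge

/-!
# PercRepro — THE ROW `70` OF LEVEL `7`: C-025 AT `q = 7` FOR EVERY FINITE MATROID AND EVERY `p ≥ 70` (p8, gen 18; a feeder
for S4 — the top of the `q = 7` window, from `71`; the first row on the GIANT-EXACT count WITH LEMMA T5)

Level `7` at rank `70` by the per-rank wrapper `rls_succ_large_at 6 7 70` (p8 g0, S3SixWindow): level `6` at `69`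
(`c025_six_all`) and the `e`-free core at `(70, d)` for every `d ≥ 8` — the cells `8 ≤ d ≤ 91` by their numeric forms ON THE
GIANT-EXACT COUNT WITH LEMMA T5 (`quart_form70gxt`, RankLevelSetLevelSevenRowSeventyGXTForm: the `N`-side
`C(n, 7) + σ_m·Π_E′ + 2^{min 79 (7+d)}` with `s₅ ≤ 7d(d+1)(d+2)(d+3)/48` — the cell `(70, 33)` FAILS on the giant-exact
count alone, `N`-side `1.010`, and closes here at `0.805`) through `c025_core_seven_of_form_gxt` (RankLevelSetCoreSevenOfFormGXT),
the coranks `d ≥ 92` by the large-corank inequality at `(70, n ≥ 162)` (`largeSeven_all70`) through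
`c025_core_seven_large_of_ineq` (RankLevelSetCoreSevenOfForm). The rows `≥ 71` are `c025_seven_large_seventy_one`.
* **`c025_core_seven_at_seventy`** — the `e`-free core at rank `70`, every corank `d ≥ 8`;
* **`c025_seven_at_seventy`** — level `7` at rank `70`, every finite matroid;
* **`c025_seven_large_seventy`** — level `7` for every `p ≥ 70`; **`c025_seven_seventy`** the same in the `C025` body.
Axioms: standard.
-/

open scoped Matroid

namespace PercRepro

namespace ThmN

variable {α : Type}

/-- **The `e`-free core of level `7` at rank `70`, every corank `d ≥ 8`**: the numeric forms of the cells `(70, 8 … 91)` on the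
giant-exact count with Lemma T5 and the large-corank inequality at `(70, n ≥ 162)`. -/
theorem c025_core_seven_at_seventy (M : Matroid α) [M.Finite] (d : ℕ) (hd8 : 8 ≤ d) (hR : M.eRank = (70 : ℕ∞))
    (hn : M.E.ncard = 70 + d) (hfree : EFree M) : RLS M 70 7 := by
  rcases Nat.lt_or_ge d 92 with h | h
  · exact c025_core_seven_of_form_gxt M 70 d hd8 hR hn hfree (quart_form70gxt d hd8 (by omega))
  · exact c025_core_seven_large_of_ineq M 70 hR (largeSeven_all70 M.E.ncard (by omega)) hfree

/-- **Level `7` at rank `70`, every finite matroid**: `rls_succ_large_at 6 7 70` on level `6` at `69` (`c025_six_all`), the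
coranks `≤ 7` (`U = ∅` or Theorem M) and the core at `70`. -/
theorem c025_seven_at_seventy (M : Matroid α) [M.Finite] : RLS M 70 7 := by
  refine rls_succ_large_at (α := α) 6 7 70 (by norm_num) (fun M _ => c025_six_all M 69 (by norm_num)) ?_ ?_ M
  · -- corank `≤ 7`: `U = ∅` or Theorem M
    intro M _ hn
    rcases Nat.lt_or_ge M.E.ncard (70 + 7) with h | h
    · exact RLS_of_ncard_lt M h
    · exact RLS_of_ncard_eq M (by omega)
  · -- the core at corank `≥ 8`
    intro M _ hR hbig hfree
    exact c025_core_seven_at_seventy M (M.E.ncard - 70) (by omega) hR (by omega) hfree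

/-- **THEOREM C₇ AT `70`, UNCONDITIONAL OVER THE TREE**: every finite matroid satisfies C-025 at level `7` for every
`p ≥ 70` — the row `70` by `c025_seven_at_seventy`, the rows `≥ 71` by `c025_seven_large_seventy_one`. -/
theorem c025_seven_large_seventy (M : Matroid α) [M.Finite] (p : ℕ) (hp : 70 ≤ p) : RLS M p 7 := by
  rcases Nat.lt_or_ge p 71 with h | h
  · have h70 : p = 70 := by omega
    subst h70
    exact c025_seven_at_seventy M
  · exact c025_seven_large_seventy_one M p h

/-- The same in the literal `C025` body: `phiK p 7 · #U(p, 7) ≤ #Y(p, 7)` for every finite matroid and every `p ≥ 70`. -/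
theorem c025_seven_seventy (M : Matroid α) [M.Finite] (p : ℕ) (hp : 70 ≤ p) :
    phiK p 7 * ({A : Set α | A ⊆ M.E ∧ M.eRk A = (p : ℕ∞) ∧ M.eRk (M.E \ A) = (7 : ℕ∞)}.ncard : ℚ) ≤
      ({A : Set α | A ⊆ M.E ∧ (7 : ℕ∞) < M.eRk A ∧ M.eRk A < (p : ℕ∞)}.ncard : ℚ) :=
  c025_seven_large_seventy M p hp

end ThmN

end PercRepro
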